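import Mathlib
import Summits.NavierStokesRegularity.NavierStokesRegularity.Theorems.SubOnsagerCeilingKPPairSlavingEnvelope
import HarnessLib

/-!
# ν-UNIFORM slaving of a secondary source — the large-viscosity branch and the two-regime envelope
(helper file for crux stmt-NavierStokesRegularity-27057 `SubOnsagerCeiling.ForwardTailCeilingKP`,
`--supports … --as helper`; LEAD SE seat ns-senv-p1 acting as KEY-NS #146 (1) / #147 (3) hands for
LEAD SOC; builds on `SubOnsagerCeilingKPPairSlaving` (p646904), `…Structural` (p647152),
`…Envelope` (p647884))

WHY. The crux quantifies `∃ C ∀ ν > 0`: every envelope must hold with ONE constant for ALL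
viscosities, large ones included. The pair slaving lemma `kpProper_source_envelope` bounds a source
`X_{a,n}` by `S` under `24 I₀² + 8 I₀ (ρ₀ + ν(1+ε₀)^{2(n+1)}) S < 7 λ² S⁴` — a condition that FAILS for
large `ν` at fixed `S` (the target's viscous decay weakens the drain it exerts on the source). The
missing branch is elementary: for large `ν` the source's OWN damping `−ν(1+ε₀)^{2n} X_{a,n}` caps it at
input/damping, `X_{a,n} ≤ I₀ / (ν(1+ε₀)^{2n})` (`damped_source_le`, a first-order comparison). Splitting
at a free threshold `ρ̄ > 0` for `ν(1+ε₀)^{2(n+1)}` gives the ν-UNIFORM form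
`kpProper_source_envelope_uniform`: if `24 I₀² + 8 I₀ (ρ₀ + ρ̄) S < 7 λ² S⁴` and `I₀ (1+ε₀)² ≤ ρ̄ S`, then
`X_{a,n} < S` on `[0,T]` for EVERY `ν ≥ 0`. With envelope-scale data (`I₀ ≍ Λ_n A_n²`, `ρ₀, ρ̄ ≍ Λ_{n+1}
A_{n+1}`, `λ ≍ Λ_n / R`) both conditions hold for `S = K·A_n`, `K = K(R, ε₀)` — so a secondary source
inherits the envelope of its neighbours uniformly in `ν ∈ (0, ∞)`, which is what an assembly towards
`FwdCeilingKPAt` (constant `C` chosen before `ν`) consumes.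

CONTENTS. §1 `damped_source_le` (ODE comparison `s' ≤ I₀ − κ s ⇒ s ≤ max (s 0) (I₀/κ)`);
§2 `kpProper_source_input_le` (the input bound `quadTerm_a(n) ≤ I₀ − λ X_{a,n} X_{e,n+1}` from neighbour
envelopes, with the in-shell form on the FACE `{X_a = 0}` — no bound on the source itself is asked) and
`kpProper_target_drain_ge` (the target's drain rate `ρ₀` from its partners' envelopes) — the two estimates
inside the proof of `kpProper_source_envelope`, exported; §3 `kpProper_source_envelope_uniform`.

HONEST FRAMING: ODE inequalities about Tao-type MODEL lattice tables (rung TL-M2Break, route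
SubOnsagerCeiling); an ingredient of, not a proof of, the crux `ForwardTailCeilingKP`; nothing here
bears on Navier–Stokes regularity.
-/

noncomputable section

-- the sub-problem namespace `NavierStokesRegularity.NavierStokesRegularity` is the tree's layout (D-0017)
set_option linter.dupNamespace false

namespace Summit.NavierStokesRegularity.NavierStokesRegularity.Theorems

open Set Finset Filter Topology
open Literature.Analysis.FluidPDE.TaoCascade

/-! ## §1 The large-viscosity branch: a linearly damped source -/

/-- **Damped source.** On `[0, T]` let `s` satisfy `s' ≤ I₀ − κ·s` with `κ > 0`. Then
`s t ≤ max (s 0) (I₀/κ)` for all `t ∈ [0,T]` (comparison with the constant barriers `max(s 0, I₀/κ) + η`,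
`η ↓ 0`). [folklore first-order ODE comparison; this file] -/
theorem damped_source_le {s s' : ℝ → ℝ} {T I₀ κ : ℝ} (hκ : 0 < κ)
    (hs : ∀ t ∈ Icc (0 : ℝ) T, HasDerivWithinAt s (s' t) (Icc (0 : ℝ) T) t)
    (hs' : ∀ t ∈ Icc (0 : ℝ) T, s' t ≤ I₀ - κ * s t) :
    ∀ t ∈ Icc (0 : ℝ) T, s t ≤ max (s 0) (I₀ / κ) := by
  intro t ht
  have hcont : ContinuousOn s (Icc (0 : ℝ) T) := fun u hu => (hs u hu).continuousWithinAt
  -- derivative within `Ici x` at every `x ∈ [0, T)`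
  have hder : ∀ x ∈ Ico (0 : ℝ) T, HasDerivWithinAt s (s' x) (Ici x) x := by
    intro x hx
    have hmem : Icc (0 : ℝ) T ∈ 𝓝[Ici x] x :=
      mem_of_superset (Icc_mem_nhdsGE hx.2) (Icc_subset_Icc hx.1 le_rfl)
    exact (hs x ⟨hx.1, hx.2.le⟩).mono_of_mem_nhdsWithin hmem
  -- compare with the constant barrier `L + η` for every `η > 0`
  set L : ℝ := max (s 0) (I₀ / κ) with hL
  suffices h : ∀ η : ℝ, 0 < η → s t ≤ L + η by
    by_contra hcon
    push Not at hcon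
    have := h ((s t - L) / 2) (by linarith)
    linarith
  intro η hη
  have hB := image_le_of_deriv_right_lt_deriv_boundary' (f := s) (f' := s') (a := 0) (b := T)
    hcont hder (B := fun _ => L + η) (B' := fun _ => 0)
    (by show s 0 ≤ L + η; linarith [le_max_left (s 0) (I₀ / κ)]) continuousOn_const
    (fun x _ => hasDerivWithinAt_const x (Ici x) (L + η))
    (by
      intro x hx hxB
      have h1 := hs' x ⟨hx.1, hx.2.le⟩
      have h2 : I₀ / κ ≤ L := le_max_right _ _
      have h3 : I₀ ≤ κ * L := by
        rw [div_le_iff₀ hκ] at h2; linarith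
      rw [hxB] at h1
      nlinarith)
  exact hB ht

/-! ## §2 The input bound of a source from neighbour envelopes -/

/-- **Inputs of a source from neighbour envelopes (face form).** For a KP network proper and a family
non-negative on shells `n, n+1` with `|X_{j,n-1}| ≤ B₀ j` and `X_{j,n} ≤ B₁ j` for `j ≠ a`: for any feed
`a → e`, `quadTerm_a(n) ≤ I₀ − w_{ae}(1+ε₀)^{5n/2} X_{a,n} X_{e,n+1}` with the explicit
`I₀ = (1+ε₀)^{5(n-1)/2} Σ_j w_{ja} (B₀ j)² + (1+ε₀)^{5n/2} Σ_{i₁,i₂ ≠ a} |α i₁ i₂ a (0,0,0)| B₁ i₁ B₁ i₂`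
(the pairs through `a` are absent: the in-shell form is evaluated on the face `{X_a = 0}`, so NO bound on
the source itself enters its input — written with `Function.update B₁ a 0`). MODEL lattice inequality.
[this file] -/
theorem kpProper_source_input_le {α : Fin 4 → Fin 4 → Fin 4 → ℤ × ℤ × ℤ → ℝ}
    (hs : IsSymmetricCoeff α) (hc : IsCancellingCoeff α)
    (hO : ∀ (Y : Fin 4 → ℤ → ℝ → ℝ) (τ : ℝ), (∀ (j : Fin 4) (k : ℤ), 1 ≤ k → 0 ≤ Y j k τ) →
      ∀ δ : ℝ, 0 < δ → ∀ (i : Fin 4) (n : ℤ), 1 ≤ n → Y i n τ = 0 → 0 ≤ quadTerm δ α Y i n τ)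
    (hD : ∀ a b i : Fin 4, a ≠ b → α a b i (0, 0, 1) = 0)
    {ε₀ : ℝ} (hε : 0 < 1 + ε₀) (X : Fin 4 → ℤ → ℝ → ℝ) (a e : Fin 4) (n : ℤ) (t : ℝ)
    {B₀ B₁ : Fin 4 → ℝ} (hB₀ : ∀ j, |X j (n - 1) t| ≤ B₀ j)
    (hn : ∀ j, 0 ≤ X j n t) (hB₁ : ∀ j, j ≠ a → X j n t ≤ B₁ j) (hn1 : ∀ j, 0 ≤ X j (n + 1) t) :
    quadTerm ε₀ α X a n t ≤
      ((1 + ε₀) ^ ((5 : ℝ) * ((n : ℝ) - 1) / 2) * ∑ j, α j j a (0, 0, 1) * B₀ j ^ 2 +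
        (1 + ε₀) ^ ((5 : ℝ) * n / 2) * ∑ i₁, ∑ i₂, |α i₁ i₂ a (0, 0, 0)| *
          (Function.update B₁ a 0 i₁ * Function.update B₁ a 0 i₂)) -
      α a a e (0, 0, 1) * (1 + ε₀) ^ ((5 : ℝ) * n / 2) * X a n t * X e (n + 1) t := by
  have hLm0 : 0 < (1 + ε₀) ^ ((5 : ℝ) * ((n : ℝ) - 1) / 2) := Real.rpow_pos_of_pos hε _
  have hL00 : 0 < (1 + ε₀) ^ ((5 : ℝ) * n / 2) := Real.rpow_pos_of_pos hε _
  have hfeed := kpProper_feed_nonneg hO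
  have h := kpProper_quadTerm_source_le hs hc hO hD hε X a e n t hn hn1
  have h1 : ∑ j, α j j a (0, 0, 1) * X j (n - 1) t ^ 2 ≤ ∑ j, α j j a (0, 0, 1) * B₀ j ^ 2 := by
    refine Finset.sum_le_sum fun j _ => mul_le_mul_of_nonneg_left ?_ (hfeed j a)
    have hab := abs_le.1 (hB₀ j)
    exact sq_le_sq' hab.1 hab.2
  -- on the face: `0 ≤ X̂_j ≤ B̂_j` coordinatewise (`X̂ = X` off `a`, `0` at `a`; same for `B̂`)
  have hx : ∀ j, 0 ≤ Function.update (fun j => X j n t) a 0 j ∧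
      Function.update (fun j => X j n t) a 0 j ≤ Function.update B₁ a 0 j := by
    intro j
    by_cases hja : j = a
    · simp [Function.update, hja]
    · simp [Function.update, hja, hn j, hB₁ j hja]
  have hBnn : ∀ j, 0 ≤ Function.update B₁ a 0 j := fun j => (hx j).1.trans (hx j).2
  have h2 : ∑ i₁, ∑ i₂, α i₁ i₂ a (0, 0, 0) *
      (Function.update (fun j => X j n t) a 0 i₁ * Function.update (fun j => X j n t) a 0 i₂) ≤
      ∑ i₁, ∑ i₂, |α i₁ i₂ a (0, 0, 0)| * (Function.update B₁ a 0 i₁ * Function.update B₁ a 0 i₂) := by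
    refine Finset.sum_le_sum fun i₁ _ => Finset.sum_le_sum fun i₂ _ => ?_
    have hp : 0 ≤ Function.update (fun j => X j n t) a 0 i₁ * Function.update (fun j => X j n t) a 0 i₂ :=
      mul_nonneg (hx i₁).1 (hx i₂).1
    have hpB : Function.update (fun j => X j n t) a 0 i₁ * Function.update (fun j => X j n t) a 0 i₂ ≤
        Function.update B₁ a 0 i₁ * Function.update B₁ a 0 i₂ :=
      mul_le_mul (hx i₁).2 (hx i₂).2 (hx i₂).1 (hBnn i₁)
    calc α i₁ i₂ a (0, 0, 0) * _ ≤ |α i₁ i₂ a (0, 0, 0)| * _ :=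
          mul_le_mul_of_nonneg_right (le_abs_self _) hp
      _ ≤ |α i₁ i₂ a (0, 0, 0)| * (Function.update B₁ a 0 i₁ * Function.update B₁ a 0 i₂) :=
          mul_le_mul_of_nonneg_left hpB (abs_nonneg _)
  have h1' := mul_le_mul_of_nonneg_left h1 hLm0.le
  have h2' := mul_le_mul_of_nonneg_left h2 hL00.le
  linarith

/-- **Drains of a target from neighbour envelopes.** For a KP network proper and a family non-negative
on shell `n+1` with `X_{j,n+1} ≤ B₂ j`, `X_{j,n+2} ≤ B₃ j`: for a feed `a → e`,
`w_{ae}(1+ε₀)^{5n/2} X_{a,n}² − ρ₀ X_{e,n+1} ≤ quadTerm_e(n+1)` with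
`ρ₀ = (1+ε₀)^{5(n+1)/2}(Σ_j w_{ej} B₃ j + Σ_j P_{e→j} B₂ j)` (the estimate inside
`kpProper_source_envelope`, exported). MODEL lattice inequality. [this file] -/
theorem kpProper_target_drain_ge {α : Fin 4 → Fin 4 → Fin 4 → ℤ × ℤ × ℤ → ℝ}
    (hs : IsSymmetricCoeff α) (hc : IsCancellingCoeff α)
    (hO : ∀ (Y : Fin 4 → ℤ → ℝ → ℝ) (τ : ℝ), (∀ (j : Fin 4) (k : ℤ), 1 ≤ k → 0 ≤ Y j k τ) →
      ∀ δ : ℝ, 0 < δ → ∀ (i : Fin 4) (n : ℤ), 1 ≤ n → Y i n τ = 0 → 0 ≤ quadTerm δ α Y i n τ)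
    (hD : ∀ a b i : Fin 4, a ≠ b → α a b i (0, 0, 1) = 0)
    {ε₀ : ℝ} (hε : 0 < 1 + ε₀) (X : Fin 4 → ℤ → ℝ → ℝ) (a e : Fin 4) (n : ℤ) (t : ℝ)
    {B₂ B₃ : Fin 4 → ℝ} (hB₂ : ∀ j, 0 ≤ X j (n + 1) t ∧ X j (n + 1) t ≤ B₂ j)
    (hB₃ : ∀ j, X j (n + 2) t ≤ B₃ j) :
    α a a e (0, 0, 1) * (1 + ε₀) ^ ((5 : ℝ) * n / 2) * X a n t ^ 2 -
        ((1 + ε₀) ^ ((5 : ℝ) * (((n + 1 : ℤ) : ℝ)) / 2) *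
          (∑ j, α e e j (0, 0, 1) * B₃ j + ∑ j, α e e j (0, 0, 0) * B₂ j)) * X e (n + 1) t ≤
      quadTerm ε₀ α X e (n + 1) t := by
  have hL10 : 0 < (1 + ε₀) ^ ((5 : ℝ) * (((n + 1 : ℤ) : ℝ)) / 2) := Real.rpow_pos_of_pos hε _
  have hfeed := kpProper_feed_nonneg hO
  have hpump : ∀ j, 0 ≤ α e e j (0, 0, 0) := by
    intro j
    by_cases hje : j = e
    · rw [hje, kpProper_inShell_diag_zero hc e]
    · exact kpProper_pump_nonneg hO hje
  have h := kpProper_quadTerm_target_ge hs hc hO hD hε X a e n t (fun j => (hB₂ j).1)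
  have hXe : 0 ≤ X e (n + 1) t := (hB₂ e).1
  have h1 : ∑ j, α e e j (0, 0, 1) * X j (n + 2) t ≤ ∑ j, α e e j (0, 0, 1) * B₃ j :=
    Finset.sum_le_sum fun j _ => mul_le_mul_of_nonneg_left (hB₃ j) (hfeed e j)
  have h2 : ∑ j, α e e j (0, 0, 0) * X j (n + 1) t ≤ ∑ j, α e e j (0, 0, 0) * B₂ j :=
    Finset.sum_le_sum fun j _ => mul_le_mul_of_nonneg_left (hB₂ j).2 (hpump j)
  have h3 : X e (n + 1) t * ((1 + ε₀) ^ ((5 : ℝ) * (((n + 1 : ℤ) : ℝ)) / 2) *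
      (∑ j, α e e j (0, 0, 1) * X j (n + 2) t + ∑ j, α e e j (0, 0, 0) * X j (n + 1) t)) ≤
      X e (n + 1) t * ((1 + ε₀) ^ ((5 : ℝ) * (((n + 1 : ℤ) : ℝ)) / 2) *
      (∑ j, α e e j (0, 0, 1) * B₃ j + ∑ j, α e e j (0, 0, 0) * B₂ j)) := by
    refine mul_le_mul_of_nonneg_left ?_ hXe
    exact mul_le_mul_of_nonneg_left (by linarith) hL10.le
  linarith

/-! ## §3 The ν-uniform envelope of a secondary source -/

/-- **PAIR SLAVING FROM NEIGHBOUR ENVELOPES, UNIFORM IN THE VISCOSITY.** KP network proper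
(`hs hc hO hD`); honest `ν`-viscous solution pieces for the source `X_{a,n}` and its target `X_{e,n+1}`
(`w = α a a e (0,0,1) > 0`, `λ = w(1+ε₀)^{5n/2}`); neighbour envelopes along `[0,T]`: `|X_{j,n-1}| ≤ B₀ j`
(feeders), `0 ≤ X_{j,n}` and `X_{j,n} ≤ B₁ j` for `j ≠ a` (face partners — NO bound on the source itself
is asked), `0 ≤ X_{j,n+1} ≤ B₂ j`, `0 ≤ X_{j,n+2} ≤ B₃ j` (the target's partners); and UPPER BOUNDS
`Ī ≥ I₀ = (1+ε₀)^{5(n-1)/2} Σ_j w_{ja}(B₀ j)² + (1+ε₀)^{5n/2} Σ_{i₁,i₂ ≠ a} |α i₁ i₂ a (0,0,0)| B₁ i₁ B₁ i₂`,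
`ρ̄₀ ≥ ρ₀ = (1+ε₀)^{5(n+1)/2}(Σ_j w_{ej} B₃ j + Σ_j P_{e→j} B₂ j)`. For every threshold `ρ̄ > 0`:
`24 Ī² + 8 Ī (ρ̄₀ + ρ̄) S < 7 λ² S⁴`, `Ī (1+ε₀)² ≤ ρ̄ S` and `X_{a,n}(0) ≤ S/2` give `X_{a,n} < S` on `[0,T]`
for EVERY `ν ≥ 0` (`ν(1+ε₀)^{2(n+1)} ≤ ρ̄`: the pair lemma `kpProper_pairSlaving`; otherwise the source's
own damping, `damped_source_le`). MODEL lattice statement. [this file] -/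
theorem kpProper_source_envelope_uniform {ε₀ ν T S ρbar Ibar ρ0bar : ℝ}
    {α : Fin 4 → Fin 4 → Fin 4 → ℤ × ℤ × ℤ → ℝ}
    {X : Fin 4 → ℤ → ℝ → ℝ} (hs : IsSymmetricCoeff α) (hc : IsCancellingCoeff α)
    (hO : ∀ (Y : Fin 4 → ℤ → ℝ → ℝ) (τ : ℝ), (∀ (j : Fin 4) (k : ℤ), 1 ≤ k → 0 ≤ Y j k τ) →
      ∀ δ : ℝ, 0 < δ → ∀ (i : Fin 4) (n : ℤ), 1 ≤ n → Y i n τ = 0 → 0 ≤ quadTerm δ α Y i n τ)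
    (hD : ∀ a b i : Fin 4, a ≠ b → α a b i (0, 0, 1) = 0)
    (hε : 0 < ε₀) (hν : 0 ≤ ν) (a e : Fin 4) (n : ℤ) (hw : 0 < α a a e (0, 0, 1)) (hS : 0 < S)
    (hρbar : 0 < ρbar)
    (hXa : ∀ t ∈ Icc 0 T, HasDerivWithinAt (X a n)
      (quadTerm ε₀ α X a n t - ν * (1 + ε₀) ^ ((2 : ℝ) * n) * X a n t) (Icc 0 T) t)
    (hXe : ∀ t ∈ Icc 0 T, HasDerivWithinAt (X e (n + 1))
      (quadTerm ε₀ α X e (n + 1) t - ν * (1 + ε₀) ^ ((2 : ℝ) * (((n + 1 : ℤ)) : ℝ)) * X e (n + 1) t)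
        (Icc 0 T) t)
    {B₀ B₁ B₂ B₃ : Fin 4 → ℝ}
    (hB₀ : ∀ t ∈ Icc 0 T, ∀ j, |X j (n - 1) t| ≤ B₀ j)
    (hB₁ : ∀ t ∈ Icc 0 T, ∀ j, 0 ≤ X j n t ∧ (j ≠ a → X j n t ≤ B₁ j))
    (hB₂ : ∀ t ∈ Icc 0 T, ∀ j, 0 ≤ X j (n + 1) t ∧ X j (n + 1) t ≤ B₂ j)
    (hB₃ : ∀ t ∈ Icc 0 T, ∀ j, 0 ≤ X j (n + 2) t ∧ X j (n + 2) t ≤ B₃ j)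
    (hIle : (1 + ε₀) ^ ((5 : ℝ) * ((n : ℝ) - 1) / 2) * ∑ j, α j j a (0, 0, 1) * B₀ j ^ 2 +
          (1 + ε₀) ^ ((5 : ℝ) * n / 2) * ∑ i₁, ∑ i₂, |α i₁ i₂ a (0, 0, 0)| *
            (Function.update B₁ a 0 i₁ * Function.update B₁ a 0 i₂) ≤ Ibar)
    (hρle : (1 + ε₀) ^ ((5 : ℝ) * (((n + 1 : ℤ) : ℝ)) / 2) *
          (∑ j, α e e j (0, 0, 1) * B₃ j + ∑ j, α e e j (0, 0, 0) * B₂ j) ≤ ρ0bar)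
    (hcond : 24 * Ibar ^ 2 + 8 * Ibar * (ρ0bar + ρbar) * S <
        7 * (α a a e (0, 0, 1) * (1 + ε₀) ^ ((5 : ℝ) * n / 2)) ^ 2 * S ^ 4)
    (hdamp : Ibar * (1 + ε₀) ^ (2 : ℝ) ≤ ρbar * S)
    (hinit : X a n 0 ≤ S / 2) :
    ∀ t ∈ Icc 0 T, X a n t < S := by
  have hb : (0 : ℝ) < 1 + ε₀ := by linarith
  by_cases hT : (0 : ℝ) ≤ T
  swap
  · intro t ht; exact absurd (ht.1.trans ht.2) hT
  have h0 : (0 : ℝ) ∈ Icc (0 : ℝ) T := ⟨le_rfl, hT⟩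
  set Lm : ℝ := (1 + ε₀) ^ ((5 : ℝ) * ((n : ℝ) - 1) / 2) with hLm
  set L0 : ℝ := (1 + ε₀) ^ ((5 : ℝ) * n / 2) with hL0
  set L1 : ℝ := (1 + ε₀) ^ ((5 : ℝ) * (((n + 1 : ℤ) : ℝ)) / 2) with hL1
  have hLm0 : 0 < Lm := Real.rpow_pos_of_pos hb _
  have hL00 : 0 < L0 := Real.rpow_pos_of_pos hb _
  have hL10 : 0 < L1 := Real.rpow_pos_of_pos hb _
  set I₀ : ℝ := Lm * ∑ j, α j j a (0, 0, 1) * B₀ j ^ 2 +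
    L0 * ∑ i₁, ∑ i₂, |α i₁ i₂ a (0, 0, 0)| * (Function.update B₁ a 0 i₁ * Function.update B₁ a 0 i₂)
    with hI₀
  set ρ₀ : ℝ := L1 * (∑ j, α e e j (0, 0, 1) * B₃ j + ∑ j, α e e j (0, 0, 0) * B₂ j) with hρ₀
  set lam : ℝ := α a a e (0, 0, 1) * (1 + ε₀) ^ ((5 : ℝ) * n / 2) with hlam
  have hlam0 : 0 < lam := mul_pos hw hL00
  have hfeed := kpProper_feed_nonneg hO
  have hpump : ∀ j, 0 ≤ α e e j (0, 0, 0) := by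
    intro j
    by_cases hje : j = e
    · rw [hje, kpProper_inShell_diag_zero hc e]
    · exact kpProper_pump_nonneg hO hje
  have hB1nn : ∀ j, 0 ≤ Function.update B₁ a 0 j := by
    intro j
    by_cases hja : j = a
    · simp [Function.update, hja]
    · have h1 := (hB₁ 0 h0 j).1
      have h2 := (hB₁ 0 h0 j).2 hja
      simp [Function.update, hja]; linarith
  have hB2nn : ∀ j, 0 ≤ B₂ j := fun j => (hB₂ 0 h0 j).1.trans (hB₂ 0 h0 j).2
  have hB3nn : ∀ j, 0 ≤ B₃ j := fun j => (hB₃ 0 h0 j).1.trans (hB₃ 0 h0 j).2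
  have hI : 0 ≤ I₀ := by
    have h1 : 0 ≤ ∑ j, α j j a (0, 0, 1) * B₀ j ^ 2 :=
      Finset.sum_nonneg fun j _ => mul_nonneg (hfeed j a) (sq_nonneg _)
    have h2 : 0 ≤ ∑ i₁, ∑ i₂, |α i₁ i₂ a (0, 0, 0)| *
        (Function.update B₁ a 0 i₁ * Function.update B₁ a 0 i₂) :=
      Finset.sum_nonneg fun i₁ _ => Finset.sum_nonneg fun i₂ _ =>
        mul_nonneg (abs_nonneg _) (mul_nonneg (hB1nn i₁) (hB1nn i₂))
    positivity
  have hρ : 0 ≤ ρ₀ := by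
    have h1 : 0 ≤ ∑ j, α e e j (0, 0, 1) * B₃ j :=
      Finset.sum_nonneg fun j _ => mul_nonneg (hfeed e j) (hB3nn j)
    have h2 : 0 ≤ ∑ j, α e e j (0, 0, 0) * B₂ j :=
      Finset.sum_nonneg fun j _ => mul_nonneg (hpump j) (hB2nn j)
    positivity
  have hIbar : I₀ ≤ Ibar := by simpa [hI₀, hLm, hL0] using hIle
  have hρbar0 : ρ₀ ≤ ρ0bar := by simpa [hρ₀, hL1] using hρle
  have hIbar0 : 0 ≤ Ibar := hI.trans hIbar
  have hρ0bar0 : 0 ≤ ρ0bar := hρ.trans hρbar0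
  -- the two structural inequalities of the pair, from the normal form and the envelopes (weakened to the bars)
  have hIn : ∀ t ∈ Icc 0 T, quadTerm ε₀ α X a n t ≤ Ibar - lam * X a n t * X e (n + 1) t := by
    intro t ht
    have h := kpProper_source_input_le hs hc hO hD hb X a e n t (hB₀ t ht) (fun j => (hB₁ t ht j).1)
      (fun j hja => (hB₁ t ht j).2 hja) (fun j => (hB₂ t ht j).1)
    have hI0eq : (1 + ε₀) ^ ((5 : ℝ) * ((n : ℝ) - 1) / 2) * ∑ j, α j j a (0, 0, 1) * B₀ j ^ 2 +
        (1 + ε₀) ^ ((5 : ℝ) * n / 2) * ∑ i₁, ∑ i₂, |α i₁ i₂ a (0, 0, 0)| *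
          (Function.update B₁ a 0 i₁ * Function.update B₁ a 0 i₂) = I₀ := by
      simp only [hI₀, hLm, hL0]
    rw [hI0eq] at h
    simp only [hlam]
    linarith
  have hOut : ∀ t ∈ Icc 0 T, lam * X a n t ^ 2 - ρ0bar * X e (n + 1) t ≤ quadTerm ε₀ α X e (n + 1) t := by
    intro t ht
    have h := kpProper_target_drain_ge hs hc hO hD hb X a e n t (hB₂ t ht) (fun j => (hB₃ t ht j).2)
    have hρ0eq : (1 + ε₀) ^ ((5 : ℝ) * (((n + 1 : ℤ) : ℝ)) / 2) *
        (∑ j, α e e j (0, 0, 1) * B₃ j + ∑ j, α e e j (0, 0, 0) * B₂ j) = ρ₀ := by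
      simp only [hρ₀, hL1]
    rw [hρ0eq] at h
    have hXe0 : 0 ≤ X e (n + 1) t := (hB₂ t ht e).1
    have : ρ₀ * X e (n + 1) t ≤ ρ0bar * X e (n + 1) t := mul_le_mul_of_nonneg_right hρbar0 hXe0
    simp only [hlam]
    linarith
  -- the viscous rate of the target's shell
  set κ1 : ℝ := ν * (1 + ε₀) ^ ((2 : ℝ) * (((n + 1 : ℤ)) : ℝ)) with hκ1
  have hκ1nn : 0 ≤ κ1 := mul_nonneg hν (Real.rpow_pos_of_pos hb _).le
  by_cases hsmall : κ1 ≤ ρbar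
  · -- SMALL VISCOSITY: the pair lemma, with `ν(1+ε₀)^{2(n+1)} ≤ ρ̄` absorbed in the condition
    have hc' : 24 * Ibar ^ 2 + 8 * Ibar * (ρ0bar + ρbar) * S < 7 * lam ^ 2 * S ^ 4 := by
      simpa [hlam] using hcond
    have hcond' : 24 * Ibar ^ 2 + 8 * Ibar * (ρ0bar + κ1) * S < 7 * lam ^ 2 * S ^ 4 := by
      have hmono : 8 * Ibar * (ρ0bar + κ1) * S ≤ 8 * Ibar * (ρ0bar + ρbar) * S := by
        have : 0 ≤ 8 * Ibar * S := by positivity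
        nlinarith
      linarith
    exact kpProper_pairSlaving hε hν a e n hXa hXe (fun t ht => (hB₁ t ht a).1)
      (fun t ht => (hB₂ t ht e).1) hw hIbar0 hρ0bar0 hS
      (by intro t ht; simpa [hlam] using hIn t ht)
      (by intro t ht; simpa [hlam] using hOut t ht)
      (by simpa [hlam, hκ1] using hcond') hinit
  · -- LARGE VISCOSITY: the source's own damping caps it at `Ī / (ν(1+ε₀)^{2n}) < Ī(1+ε₀)²/ρ̄ ≤ S`
    push Not at hsmall
    set κ0 : ℝ := ν * (1 + ε₀) ^ ((2 : ℝ) * n) with hκ0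
    have hb2 : (1 + ε₀) ^ ((2 : ℝ) * (((n + 1 : ℤ)) : ℝ)) =
        (1 + ε₀) ^ ((2 : ℝ) * n) * (1 + ε₀) ^ (2 : ℝ) := by
      rw [← Real.rpow_add hb]; congr 1; push_cast; ring
    have hκrel : κ1 = κ0 * (1 + ε₀) ^ (2 : ℝ) := by
      simp only [hκ1, hκ0, hb2]; ring
    have hb2pos : 0 < (1 + ε₀) ^ (2 : ℝ) := Real.rpow_pos_of_pos hb _
    have hνpos : 0 < ν := by
      rcases hν.lt_or_eq with h | h
      · exact h
      · exfalso
        have : κ1 = 0 := by rw [hκ1, ← h, zero_mul]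
        linarith
    have hκ0pos : 0 < κ0 := mul_pos hνpos (Real.rpow_pos_of_pos hb _)
    have hs' : ∀ t ∈ Icc 0 T,
        quadTerm ε₀ α X a n t - ν * (1 + ε₀) ^ ((2 : ℝ) * n) * X a n t ≤ Ibar - κ0 * X a n t := by
      intro t ht
      have h := hIn t ht
      have hXa0 : 0 ≤ X a n t := (hB₁ t ht a).1
      have hXe0 : 0 ≤ X e (n + 1) t := (hB₂ t ht e).1
      have hdr : 0 ≤ lam * X a n t * X e (n + 1) t := mul_nonneg (mul_nonneg hlam0.le hXa0) hXe0
      simp only [hκ0]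
      linarith
    have hcap := damped_source_le hκ0pos hXa hs'
    intro t ht
    have h1 := hcap t ht
    have h2 : Ibar / κ0 < S := by
      have hIb : Ibar * (1 + ε₀) ^ (2 : ℝ) < κ1 * S :=
        lt_of_le_of_lt hdamp (mul_lt_mul_of_pos_right hsmall hS)
      rw [hκrel] at hIb
      have hI' : Ibar < κ0 * S := by
        have : Ibar * (1 + ε₀) ^ (2 : ℝ) < (κ0 * S) * (1 + ε₀) ^ (2 : ℝ) := by nlinarith
        exact lt_of_mul_lt_mul_right this hb2pos.le
      rw [div_lt_iff₀ hκ0pos]; linarith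
    have h3 : X a n 0 < S := by linarith
    calc X a n t ≤ max (X a n 0) (Ibar / κ0) := h1
      _ < S := max_lt h3 h2

end Summit.NavierStokesRegularity.NavierStokesRegularity.Theorems

end
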